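import Summits.SmoothPoincare4.SmoothPoincare4.Theorems.EntropyRungChangGurskyYangStubLinearisedInvertibleOfChartRep
import Summits.SmoothPoincare4.SmoothPoincare4.Theorems.EntropyRungChangGurskyYangHelperLinearisedChartRep
import HarnessLib

/-!
# Stub O2 `stub_linearisedInvertible` (line `margerin-cone-hamilton-rails`,
crux `EntropyRung.ChangGurskyYang`, stmt-SmoothPoincare4-10834)

Gursky–Viaclovsky 2003, Prop. 2: at a smooth admissible solution `w` of the weighted `σ₂` path
equation (`t ≤ 1`, `q > 0` smooth) every bounded `L : C^{2,α}_𝔄(M) → C^{0,α}_𝔄(M)` acting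
pointwise as the linearisation `𝓛_{t,w} + 4 q e^{−4w}` is invertible. Assembly of the two wave-2
pieces: the chart-representation package of `−L` (`helper_linearisedChartRep`, stub O2a) fed to
the method-of-continuity assembly `stub_linearisedInvertible_of_chartRep` (stub O2b); the only
adapter binds the chart restriction `η_j (u ∘ chart_j⁻¹)` to the variable `v` of the package.

## References

* M. J. Gursky, J. A. Viaclovsky, J. Differential Geom. 63 (2003) 131–154, Prop. 2, §5.
  [GurskyViaclovsky2003]
* D. Gilbarg, N. S. Trudinger, *Elliptic Partial Differential Equations of Second Order* (2001),
  Thm. 5.2, Thm. 6.2. [GilbargTrudinger2001]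
-/

noncomputable section

set_option linter.dupNamespace false

open Set Function Filter
open scoped Manifold ContDiff Topology NNReal
open Literature.Analysis.FunctionSpaces Literature.Geometry.Riemannian
  Literature.Geometry.Riemannian.GurskyViaclovskyPath
open Literature.Geometry.Lorentzian Literature.Geometry.Lorentzian.PseudoRiemannianMetric

namespace Summit.SmoothPoincare4.SmoothPoincare4.Theorems.MargerinRails

/-- **STUB O2 — GURSKY–VIACLOVSKY PROP. 2: THE LINEARISATION AT A SMOOTH ADMISSIBLE SOLUTION WITH
`t ≤ 1` IS AN ISOMORPHISM `C^{2,α}_𝔄 → C^{0,α}_𝔄`.** Every bounded `L` acting pointwise as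
`φ ↦ 𝓛_{t,w}φ + 4q e^{−4w}φ` is invertible: the chart representation of `−L`
(`helper_linearisedChartRep`) and the method of continuity from `Δ_g − 1`
(`stub_linearisedInvertible_of_chartRep`).
[cite: GurskyViaclovsky2003, §2, Prop. 2; GilbargTrudinger2001, Thm. 5.2 and Thm. 6.2] -/
theorem stub_linearisedInvertible :
    ∀ (M : Type) [TopologicalSpace M] [T2Space M] [ChartedSpace (EuclideanSpace ℝ (Fin 4)) M]
      [IsManifold (𝓡 4) ∞ M] [CompactSpace M] {ι : Type} [Fintype ι]
      (𝔄 : HolderChartData ι (EuclideanSpace ℝ (Fin 4)) M)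
      (g : PseudoRiemannianMetric (𝓡 4) ∞ (EuclideanSpace ℝ (Fin 4)) (TangentSpace (𝓡 4) : M → Type _))
      [g.HasLeviCivita], g.IsRiemannian →
      ∀ (q : M → ℝ), ContMDiff (𝓡 4) 𝓘(ℝ) ∞ q → (∀ x, 0 < q x) → ∀ {α : ℝ≥0}, 0 < α → α < 1 →
      ∀ (t : ℝ), t ≤ 1 → ∀ (w : M → ℝ), ContMDiff (𝓡 4) 𝓘(ℝ) ∞ w →
      (∀ x, 0 < backgroundScalar g w x) →
      (∀ x, backgroundPathOperator g t w x = q x * Real.exp (-4 * w x)) →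
      ∀ L : HolderManifoldFunction 𝔄 ℝ 2 α →L[ℝ] HolderManifoldFunction 𝔄 ℝ 0 α,
        (∀ (φ : HolderManifoldFunction 𝔄 ℝ 2 α) (x : M),
          L φ x = linearisedBackgroundOperator g t w φ x + 4 * q x * Real.exp (-4 * w x) * φ x) →
        L.IsInvertible := by
  intro M _ _ _ _ _ ι _ 𝔄 g _ hg q hq hq0 α hα0 hα1 t ht w hw hpos heq L hL
  obtain ⟨a, b, c, ρ₁, l, U, Ka, Kb, Kc, h1, h2, h3, h4, h5, h6, h7, h8, h9, h10, h11, hrep⟩ :=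
    helper_linearisedChartRep M 𝔄 g hg q hq hq0 hα0 hα1 t ht w hw hpos heq
  exact stub_linearisedInvertible_of_chartRep M 𝔄 g hg q hq hq0 hα0 hα1 t ht w hw hpos heq
    ⟨a, b, c, ρ₁, l, U, Ka, Kb, Kc, h1, h2, h3, h4, h5, h6, h7, h8, h9, h10, h11,
      fun L' hL' u j y v hv => by subst hv; exact hrep L' hL' u j y⟩ L hL

end Summit.SmoothPoincare4.SmoothPoincare4.Theorems.MargerinRails

end
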